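import Literature.NumberTheory.CubicFields.SingularZeroTransport
import Literature.NumberTheory.CubicFields.SubringForms
import HarnessLib

/-!
# Non-maximality at `ℓ` is unchanged by operations of index prime to `ℓ`

Topic `Literature/NumberTheory/CubicFields`; built on `MemUCriterion.lean` (Davenport–Heilbronn's description:
`f ∉ U_ℓ` iff `ℓ ∣ f` or `f` has a singular zero — coprime `(x, y)` with `ℓ² ∣ f(x,y)`, `ℓ ∣ f_u(x,y)`,
`ℓ ∣ f_v(x,y)`), `SingularZeroTransport.lean` (chain rule `derivU_subst`, `rowMul`) and `SubringForms.lean`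
(`D · f = g ∘ N` for `φ : R(f) → R(g)` with `D = det N = detOnQuot φ`). Everything here is PROVED.

Bhargava–Taniguchi–Thorne 2023 use throughout §§4–5 (Lemma 2.3, the proof of Prop. 5.1: "each ring `R` with
`d₄d₃ > 1` is contained in an overring `R'` of index `d₄d₃`", obtained one prime at a time) the fact that
maximality or non-maximality of a cubic ring AT A PRIME `ℓ` only depends on `R ⊗ ℤ_ℓ`, hence is unchanged
under passing to an overring or subring of index prime to `ℓ`, and under dividing a form by an integer prime
to `ℓ`. On the side of forms (`f ∈ U_ℓ`, BTT Prop. 2.2) we prove: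

* `not_memU_smul_iff` — `c·f ∉ U_ℓ ↔ f ∉ U_ℓ` for `ℓ ∤ c`;
* `not_memU_of_subst` — if `g ∘ M ∉ U_ℓ` for an integral matrix `M` with `ℓ ∤ det M`, then `g ∉ U_ℓ`
  (a singular zero `(x, y)` of `g ∘ M` gives the singular zero `(x, y)M` of `g`, made primitive modulo `ℓ²`);
* **`not_memU_of_ringHom`** — if `φ : R(f) → R(g)` is a ring homomorphism with `ℓ ∤ detOnQuot φ` (e.g. an
  embedding of index prime to `ℓ`) and `f ∉ U_ℓ`, then `g ∉ U_ℓ`: non-maximality at `ℓ` passes to overrings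
  of index prime to `ℓ` (the converse direction, maximality passing to all overrings, is
  `MemU.of_injective`).

## References

* M. Bhargava, T. Taniguchi, F. Thorne, *Improved error estimates for the Davenport–Heilbronn theorems*,
  Math. Ann. 389 (2024) = arXiv:2107.12819, Prop. 2.2, Lemma 2.3, §5 [BhargavaTaniguchiThorne2023].
* H. Davenport, H. Heilbronn, *On the density of discriminants of cubic fields II*, Proc. Roy. Soc. London
  A 322 (1971), §2 [DavenportHeilbronn1971].
-/

namespace Literature.NumberTheory.CubicFields

namespace BinaryCubic

section CommRing

variable {R : Type*} [CommRing R]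

/-- **Substituting the adjugate undoes a substitution up to `det³`**: `(g ∘ M) ∘ adj(M) = (det M)³ · g`
(`adj(M) M = det M · 1` and `g((u,v)·d) = d³ g(u,v)`). [folklore] -/
theorem subst_subst_adj (g : BinaryCubic R) (M : Matrix (Fin 2) (Fin 2) R) :
    (g.subst M).subst !![M 1 1, -M 0 1; -M 1 0, M 0 0] = M.det ^ 3 • g := by
  ext <;> simp only [subst, smul_a, smul_b, smul_c, smul_d, Matrix.det_fin_two, Matrix.of_apply, Matrix.cons_val',
    Matrix.cons_val_zero, Matrix.cons_val_one, Matrix.cons_val_fin_one, Matrix.empty_val'] <;> ring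

end CommRing

variable {ℓ : ℕ}

/-- `ℓ ∣ c·f ↔ ℓ ∣ f` for `ℓ` prime to `c` (coefficientwise). [folklore] -/
theorem isMultiple_smul_iff (hℓ : ℓ.Prime) {c : ℤ} (hc : ¬ (ℓ : ℤ) ∣ c) (f : BinaryCubic ℤ) :
    (c • f).IsMultiple ℓ ↔ f.IsMultiple ℓ := by
  have hℓ' : Prime (ℓ : ℤ) := Nat.prime_iff_prime_int.mp hℓ
  have key : ∀ t : ℤ, (ℓ : ℤ) ∣ c * t ↔ (ℓ : ℤ) ∣ t := fun t =>
    ⟨fun h => (hℓ'.dvd_or_dvd h).resolve_left hc, fun h => dvd_mul_of_dvd_right h c⟩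
  simp only [IsMultiple, smul_a, smul_b, smul_c, smul_d, key]

/-- **`c·f ∉ U_ℓ ↔ f ∉ U_ℓ` for `ℓ ∤ c`** (`ℓ` prime): a singular zero of `c·f` is one of `f` and conversely,
and `ℓ ∣ c·f ↔ ℓ ∣ f`. [folklore] -/
theorem not_memU_smul_iff (hℓ : ℓ.Prime) {c : ℤ} (hc : ¬ (ℓ : ℤ) ∣ c) (f : BinaryCubic ℤ) :
    ¬ (c • f).MemU ℓ ↔ ¬ f.MemU ℓ := by
  have hℓ' : Prime (ℓ : ℤ) := Nat.prime_iff_prime_int.mp hℓ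
  have hcop : IsCoprime ((ℓ : ℤ) ^ 2) c := ((Prime.coprime_iff_not_dvd hℓ').mpr hc).pow_left
  have key1 : ∀ t : ℤ, (ℓ : ℤ) ∣ c * t ↔ (ℓ : ℤ) ∣ t := fun t =>
    ⟨fun h => (hℓ'.dvd_or_dvd h).resolve_left hc, fun h => dvd_mul_of_dvd_right h c⟩
  have key2 : ∀ t : ℤ, (ℓ : ℤ) ^ 2 ∣ c * t ↔ (ℓ : ℤ) ^ 2 ∣ t := fun t =>
    ⟨fun h => hcop.dvd_of_dvd_mul_left h, fun h => dvd_mul_of_dvd_right h c⟩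
  rw [not_memU_iff_exists_singular_zero, not_memU_iff_exists_singular_zero, isMultiple_smul_iff hℓ hc]
  simp only [eval_smul, derivU_smul, derivV_smul, key1, key2]

/-- From `ℓ ∣ αA + βB`, `ℓ ∣ γA + δB` and `ℓ ∤ αδ − βγ` (`ℓ` prime): `ℓ ∣ A` and `ℓ ∣ B`. [folklore] -/
theorem dvd_of_dvd_combinations_of_not_dvd_det (hℓ : ℓ.Prime) {α β γ δ A B : ℤ}
    (hdet : ¬ (ℓ : ℤ) ∣ α * δ - β * γ) (h1 : (ℓ : ℤ) ∣ α * A + β * B) (h2 : (ℓ : ℤ) ∣ γ * A + δ * B) :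
    (ℓ : ℤ) ∣ A ∧ (ℓ : ℤ) ∣ B := by
  have hℓ' : Prime (ℓ : ℤ) := Nat.prime_iff_prime_int.mp hℓ
  have hA : (ℓ : ℤ) ∣ (α * δ - β * γ) * A := by
    have : (α * δ - β * γ) * A = δ * (α * A + β * B) - β * (γ * A + δ * B) := by ring
    rw [this]; exact dvd_sub (dvd_mul_of_dvd_right h1 δ) (dvd_mul_of_dvd_right h2 β)
  have hB : (ℓ : ℤ) ∣ (α * δ - β * γ) * B := by
    have : (α * δ - β * γ) * B = α * (γ * A + δ * B) - γ * (α * A + β * B) := by ring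
    rw [this]; exact dvd_sub (dvd_mul_of_dvd_right h2 α) (dvd_mul_of_dvd_right h1 γ)
  exact ⟨(hℓ'.dvd_or_dvd hA).resolve_left hdet, (hℓ'.dvd_or_dvd hB).resolve_left hdet⟩

/-- Lifting a point `≢ (0,0) (mod ℓ)` to a primitive point in the same class modulo `ℓ²`. [folklore] -/
theorem exists_isCoprime_congr_sq (hℓ : ℓ.Prime) {r₀ s₀ : ℤ} (h : ¬ ((ℓ : ℤ) ∣ r₀ ∧ (ℓ : ℤ) ∣ s₀)) :
    ∃ r s : ℤ, IsCoprime r s ∧ (ℓ : ℤ) ^ 2 ∣ r - r₀ ∧ (ℓ : ℤ) ^ 2 ∣ s - s₀ := by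
  have hℓ' : Prime (ℓ : ℤ) := Nat.prime_iff_prime_int.mp hℓ
  -- if `ℓ ∤ t` then some `r ≡ r₀ (mod ℓ²)` is coprime to `t`
  have key : ∀ r₀ t : ℤ, ¬ (ℓ : ℤ) ∣ t → ∃ r : ℤ, IsCoprime r t ∧ (ℓ : ℤ) ^ 2 ∣ r - r₀ := by
    intro r₀ t ht
    obtain ⟨m, n, hmn⟩ := ((Prime.coprime_iff_not_dvd hℓ').mpr ht).pow_left (m := 2)
    refine ⟨r₀ + (1 - r₀) * m * (ℓ : ℤ) ^ 2, ⟨1, n * (1 - r₀), by linear_combination (1 - r₀) * hmn⟩,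
      ⟨(1 - r₀) * m, by ring⟩⟩
  by_cases hs : (ℓ : ℤ) ∣ s₀
  · have hr : ¬ (ℓ : ℤ) ∣ r₀ := fun hr => h ⟨hr, hs⟩
    obtain ⟨s, hcop, hs'⟩ := key s₀ r₀ hr
    exact ⟨r₀, s, hcop.symm, by simp, hs'⟩
  · obtain ⟨r, hcop, hr'⟩ := key r₀ s₀ hs
    exact ⟨r, s₀, hcop, hr', by simp⟩

/-- Values of `g` modulo `ℓ²` and of `g_u, g_v` modulo `ℓ` only depend on the point modulo `ℓ²`. [folklore] -/
theorem dvd_eval_of_dvd_sub_sq (g : BinaryCubic ℤ) {r s r₀ s₀ : ℤ} (hr : (ℓ : ℤ) ^ 2 ∣ r - r₀) (hs : (ℓ : ℤ) ^ 2 ∣ s - s₀) :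
    ((ℓ : ℤ) ^ 2 ∣ g.eval r₀ s₀ → (ℓ : ℤ) ^ 2 ∣ g.eval r s) ∧ ((ℓ : ℤ) ∣ g.derivU r₀ s₀ → (ℓ : ℤ) ∣ g.derivU r s) ∧
      ((ℓ : ℤ) ∣ g.derivV r₀ s₀ → (ℓ : ℤ) ∣ g.derivV r s) := by
  have h2 := dvd_eval_of_dvd_sub (f := g) (p := ℓ ^ 2) (by exact_mod_cast hr) (by exact_mod_cast hs)
  have hr1 : (ℓ : ℤ) ∣ r - r₀ := (dvd_pow_self (ℓ : ℤ) two_ne_zero).trans hr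
  have hs1 : (ℓ : ℤ) ∣ s - s₀ := (dvd_pow_self (ℓ : ℤ) two_ne_zero).trans hs
  have h1 := dvd_eval_of_dvd_sub (f := g) (p := ℓ) hr1 hs1
  refine ⟨fun h => ?_, h1.2.1, h1.2.2⟩
  have := h2.1 (by exact_mod_cast h)
  exact_mod_cast this

/-- **If `g ∘ M ∉ U_ℓ` with `ℓ ∤ det M` then `g ∉ U_ℓ`** (`ℓ` prime, `M` any integral `2 × 2` matrix): if
`ℓ ∣ g ∘ M` then `ℓ ∣ (g ∘ M) ∘ adj M = (det M)³ g`, so `ℓ ∣ g`; and a singular zero `(x, y)` of `g ∘ M` yields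
the point `(x, y)M ≢ 0 (mod ℓ)` at which `ℓ² ∣ g`, `ℓ ∣ g_u, g_v` (chain rule, `det M` invertible mod `ℓ`), which
lifts to a primitive singular zero of `g`. [folklore] -/
theorem not_memU_of_subst (hℓ : ℓ.Prime) {M : Matrix (Fin 2) (Fin 2) ℤ} (hM : ¬ (ℓ : ℤ) ∣ M.det)
    {g : BinaryCubic ℤ} (h : ¬ (g.subst M).MemU ℓ) : ¬ g.MemU ℓ := by
  have hℓ' : Prime (ℓ : ℤ) := Nat.prime_iff_prime_int.mp hℓ
  rw [not_memU_iff_exists_singular_zero] at h ⊢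
  rcases h with hm | ⟨x, y, hxy, h2, hu, hv⟩
  · -- `ℓ ∣ g ∘ M ⇒ ℓ ∣ (det M)³ g ⇒ ℓ ∣ g`
    left
    obtain ⟨k, hk⟩ := isMultiple_iff_exists_smul.mp hm
    have hdet3 : ¬ (ℓ : ℤ) ∣ M.det ^ 3 := fun h => hM (hℓ'.dvd_of_dvd_pow h)
    have h3 : (M.det ^ 3 • g).IsMultiple ℓ := by
      rw [← subst_subst_adj, hk, smul_subst]
      exact isMultiple_iff_exists_smul.mpr ⟨_, rfl⟩
    exact (isMultiple_smul_iff hℓ hdet3 g).mp h3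
  · right
    -- the point `(x', y') = (x, y) M`
    set x' := x * M 0 0 + y * M 1 0 with hx'
    set y' := x * M 0 1 + y * M 1 1 with hy'
    rw [eval_subst] at h2
    rw [show (g.subst M).derivU x y = M 0 0 * g.derivU x' y' + M 0 1 * g.derivV x' y' from derivU_subst g M (x, y)] at hu
    rw [show (g.subst M).derivV x y = M 1 0 * g.derivU x' y' + M 1 1 * g.derivV x' y' from derivV_subst g M (x, y)] at hv
    have hdet' : ¬ (ℓ : ℤ) ∣ M 0 0 * M 1 1 - M 0 1 * M 1 0 := by rwa [Matrix.det_fin_two] at hM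
    obtain ⟨hgu, hgv⟩ := dvd_of_dvd_combinations_of_not_dvd_det hℓ hdet' hu hv
    -- `(x', y') ≢ (0, 0) (mod ℓ)`: otherwise `ℓ ∣ det M · x, det M · y`, so `ℓ ∣ x, y`, contradicting coprimality
    have hnd : ¬ ((ℓ : ℤ) ∣ x' ∧ (ℓ : ℤ) ∣ y') := by
      rintro ⟨hx, hy⟩
      have hdx : (ℓ : ℤ) ∣ M.det * x := by
        have : M.det * x = M 1 1 * x' - M 1 0 * y' := by rw [Matrix.det_fin_two, hx', hy']; ring
        rw [this]; exact dvd_sub (dvd_mul_of_dvd_right hx _) (dvd_mul_of_dvd_right hy _)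
      have hdy : (ℓ : ℤ) ∣ M.det * y := by
        have : M.det * y = -M 0 1 * x' + M 0 0 * y' := by rw [Matrix.det_fin_two, hx', hy']; ring
        rw [this]; exact dvd_add (dvd_mul_of_dvd_right hx _) (dvd_mul_of_dvd_right hy _)
      have hx1 : (ℓ : ℤ) ∣ x := (hℓ'.dvd_or_dvd hdx).resolve_left hM
      have hy1 : (ℓ : ℤ) ∣ y := (hℓ'.dvd_or_dvd hdy).resolve_left hM
      obtain ⟨a, b, hab⟩ := hxy
      have h1 : (ℓ : ℤ) ∣ 1 := by rw [← hab]; exact dvd_add (dvd_mul_of_dvd_right hx1 a) (dvd_mul_of_dvd_right hy1 b)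
      exact hℓ'.not_dvd_one h1
    obtain ⟨r, s, hrs, hr, hs⟩ := exists_isCoprime_congr_sq hℓ hnd
    obtain ⟨e1, e2, e3⟩ := dvd_eval_of_dvd_sub_sq g hr hs
    exact ⟨r, s, hrs, e1 h2, e2 hgu, e3 hgv⟩

/-- **Non-maximality at `ℓ` passes along ring homomorphisms of index prime to `ℓ`**: if `φ : R(f) → R(g)` has
`ℓ ∤ detOnQuot φ` (for an embedding: index `|detOnQuot φ|` prime to `ℓ`) and `f ∉ U_ℓ`, then `g ∉ U_ℓ` — from
`detOnQuot φ · f = g ∘ N_φ` (`RingOfForm.smul_eq_subst`). With `MemU.of_injective` (maximality at `ℓ` passes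
to every overring) this says that for index prime to `ℓ`, `f ∈ U_ℓ ↔ g ∈ U_ℓ`: maximality at `ℓ` is a property
of `R ⊗ ℤ_ℓ` (BTT Lemma 2.3, §5: overrings of index `d₄d₃` built one prime at a time). [cite: BhargavaTaniguchiThorne2023, Lemma 2.3 with Prop. 2.2 (maximality at p under overrings of index prime to p)] -/
theorem not_memU_of_ringHom (hℓ : ℓ.Prime) {f g : BinaryCubic ℤ} (φ : RingOfForm f →+* RingOfForm g)
    (hdet : ¬ (ℓ : ℤ) ∣ RingOfForm.detOnQuot φ) (hf : ¬ f.MemU ℓ) : ¬ g.MemU ℓ := by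
  have h1 : ¬ (RingOfForm.detOnQuot φ • f).MemU ℓ := (not_memU_smul_iff hℓ hdet f).mpr hf
  rw [RingOfForm.smul_eq_subst] at h1
  exact not_memU_of_subst hℓ (by rwa [RingOfForm.det_substMatrix]) h1

end BinaryCubic

end Literature.NumberTheory.CubicFields
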